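import Summits.QuantumFields.GaugeBoot.TiltedLinkRPPositivity
import HarnessLib

/-!
# Link (mid-plane) reflection positivity of a periodic lattice with a site frame, COVARIANT form
(gauge-boot, L3(υ) part 5b)

HONEST FRAMING (cell `pub-gaugeboot`, page 1 of every file): the venture produces certified bounds
on lattice expectations at stated coupling, gauge group, dimension and torus size; NOT a mass gap,
NOT a continuum limit, NOT a string tension; NOT Yang–Mills-summit-bearing (barriers
`FixedCouplingUltralocality`, `PerturbativeInvisibility`).

`TiltedLinkRPPositivity.lean` (`IsSiteFrame.linkRP_integral_conj_mul_nonneg`) is the PLAIN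
Osterwalder–Seiler link positivity of the Wilson measure `gibbs ρ e β` of a periodic lattice
`(A, e)` carrying a site frame `IsSiteFrame e k σ Q h`: `0 ≤ ∫ conj F(ΘU) F(U) dμ_β` for
observables `F` of the closed half `{1 ≤ h ≤ Q}`. As on the cubic torus
(`ConstructiveQFTWave0CovariantRPProofs`), the proof in fact handles the COVARIANT observables of
Wilson loops bisected by the hyperplane `h = ½`: if a bounded measurable `Φ` satisfies
`Φ (midTranslate Y U) = Σ_κ g_κ(splice_C(U, Y)) · conj g_κ(Θ U)` for finitely many bounded
measurable `g_κ` depending only on the positive and crossing links `P ∪ C`, then `∫ Φ dμ_β ≥ 0`.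
This file proves that extension, reusing `TiltedLinkRPCrossing` / `TiltedLinkRPPositivity`
verbatim:

* `IsSiteFrame.midGObs_congr_of_posCross` — `g · e^{βA}` for `g` depending on `P ∪ C`;
* `IsSiteFrame.midCovIntegrand_midTranslate` — the pointwise identity after the substitution:
  `e^{-β S(T_Y U)} Φ(T_Y U) = Σ_κ R_{g_κ}(U, Y)` (`R` = `midIntegrand₂`);
* `IsSiteFrame.integral_midCov_nonneg` — `0 ≤ ∫ e^{-β S} Φ ∏ dU` (the abstract mechanism
  `LatticeRP.integral_mul_conj_mul_exp_nonneg` summed over `κ`);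
* ★★ **`IsSiteFrame.linkRP_nonneg_of_covariant`** — `0 ≤ ∫ Φ dμ_β` (`β ≥ 0`, continuous `ρ`,
  compact second countable `G`).

Sequels: the tilted-box instance and the transfer to the tilted limit points
(`TiltedBoxCovariantLinkRP.lean`, `TiltedBoxLimitCovariantLinkRP.lean`), giving the `ℤ^d`
property `IsCovariantLinkRP k μ` (`ZdCovariantLinkRP.lean`) — and with it Kazakov–Zheng's cut-loop
`R_link` word blocks — for every Class-T limit point along every axis `k ∉ {i, j}`.

References: K. Osterwalder, E. Seiler, Ann. Phys. 110 (1978) 440, §2; E. Seiler, LNP 159 (1982)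
Thm. 2.2; V. Kazakov, Z. Zheng, arXiv:2203.11360 §3.1. [folklore] mechanism.
-/

noncomputable section

open MeasureTheory Complex
open scoped ComplexOrder ComplexConjugate
open Literature.MathematicalPhysics.QuantumFieldTheory (haarProbability LatticeRP.splice
  LatticeRP.splice_apply LatticeRP.measurable_splice LatticeRP.integral_mul_conj_mul_exp_nonneg
  LatticeRP.integral_comp_eq_of_measurePreserving)
open Literature.RepresentationTheory.CompactGroups

namespace Summit.QuantumFields.GaugeBoot

namespace TiltedRP

namespace IsSiteFrame

variable {A : Type*} [AddCommGroup A] [Fintype A] {d : ℕ}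
variable {e : Fin d → A} {k : Fin d} {σ : A →+ A} {Q : ℕ} {h : A →+ ZMod (2 * Q)}
variable (hF : IsSiteFrame e k σ Q h)
variable {N : ℕ} {G : Type*} [Group G] [TopologicalSpace G] [IsTopologicalGroup G] [CompactSpace G]
  [MeasurableSpace G] [BorelSpace G] [SecondCountableTopology G]
variable (ρ : G →* Matrix (Fin N) (Fin N) ℂ)
include hF

/-! ## Coefficient observables depending on `P ∪ C` -/

open scoped Classical in
omit [TopologicalSpace G] [IsTopologicalGroup G] [CompactSpace G] [MeasurableSpace G] [BorelSpace G]
  [SecondCountableTopology G] in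
/-- `g · e^{βA}` depends only on `P ∪ C` if `g` does (the positive part `A` of the action depends
on `P`). -/
theorem midGObs_congr_of_posCross (β : ℝ) {g : Config A d G → ℂ}
    (hg : ∀ U V : Config A d G,
      (∀ l, IsMidPosLink e Q h l ∨ IsMidCrossLink k Q h l → U l = V l) → g U = g V)
    {U V : Config A d G} (hUV : ∀ l, IsMidPosLink e Q h l ∨ IsMidCrossLink k Q h l → U l = V l) :
    midGObs ρ e k Q h β g U = midGObs ρ e k Q h β g V := by
  have hP : ∀ l, IsMidPosLink e Q h l → U l = V l := fun l hl => hUV l (Or.inl hl)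
  simp only [midGObs, hg U V hUV, hF.sum_pos_congr ρ hP]

/-! ## The pointwise identity for covariant observables -/

open scoped Classical in
omit [MeasurableSpace G] [BorelSpace G] [SecondCountableTopology G] in
/-- **The pointwise identity for covariant observables**: if
`Φ (midTranslate Y U) = Σ_κ g_κ(z) · conj g_κ(ΘU)`, `z = splice_C(U, Y)`, then
`e^{-β S(T_Y U)} Φ(T_Y U) = Σ_κ e^{-βN#plaq} (g_κ e^{βA})(z) conj (g_κ e^{βA})(ΘU) exp(Σ_ι a_ι(z) conj a_ι(ΘU))`
— the sum over `κ` of the doubled integrands `midIntegrand₂` of `TiltedLinkRPPositivity.lean`. -/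
theorem midCovIntegrand_midTranslate (hρ : Continuous ρ) {β : ℝ} (hβ : 0 ≤ β) {K : Type*}
    [Fintype K] {g : K → Config A d G → ℂ} {Φ : Config A d G → ℂ}
    (hcov : ∀ U Y, Φ (midTranslate k Q h Y U) =
      ∑ κ, g κ (LatticeRP.splice (midCrossBlock k Q h) (U, Y)) * conj (g κ (configMidReflect e k σ U)))
    (U Y : Config A d G) :
    (Real.exp (-β * wilsonAction ρ e (midTranslate k Q h Y U)) : ℂ) * Φ (midTranslate k Q h Y U) =
      ∑ κ, midIntegrand₂ ρ e k σ Q h hρ β (g κ) (U, Y) := by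
  have hPC : ∀ l : Link A d, IsMidPosLink e Q h l → ¬ IsMidCrossLink k Q h l :=
    fun l hl hc => hF.not_isMidPosLink_of_isMidCrossLink hc hl
  have htr : ∀ l, IsMidPosLink e Q h l → midTranslate k Q h Y U l = U l :=
    fun l hl => midTranslate_apply_of_not_isMidCrossLink Y U (hPC l hl)
  have hsp : ∀ l, IsMidPosLink e Q h l → LatticeRP.splice (midCrossBlock k Q h) (U, Y) l = U l :=
    fun l hl => splice_apply_of_not_isMidCrossLink U Y (hPC l hl)
  have hΘtr : ∀ l, IsMidPosLink e Q h l →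
      configMidReflect e k σ (midTranslate k Q h Y U) l = configMidReflect e k σ U l := by
    intro l hl
    simp only [configMidReflect,
      midTranslate_apply_of_not_isMidCrossLink Y U (hF.not_isMidCrossLink_midLinkMap hl)]
  have hA1 := hF.sum_pos_congr ρ htr
  have hA2 := hF.sum_pos_congr ρ hΘtr
  have hA3 := hF.sum_pos_congr ρ hsp
  rw [hcov, wilsonAction_eq, hF.sum_plaqObs_split_mid ρ hρ (midTranslate k Q h Y U), hA1, hA2,
    Finset.mul_sum]
  refine Finset.sum_congr rfl fun κ _ => ?_
  unfold midIntegrand₂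
  rw [hF.sum_midCoeff_mul_conj ρ hρ hβ, midGObs, midGObs, hA3, ← Complex.ofReal_exp]
  set A1 := ∑ p ∈ Finset.univ.filter (IsMidPosPlaq k Q h), plaqObs ρ e p U
  set A2 := ∑ p ∈ Finset.univ.filter (IsMidPosPlaq k Q h), plaqObs ρ e p (configMidReflect e k σ U)
  set X := ∑ p ∈ Finset.univ.filter (IsMidCrossPlaq k Q h), plaqObs ρ e p (midTranslate k Q h Y U)
  simp only [map_mul, Complex.conj_ofReal]
  rw [show -β * (↑N * ↑(Fintype.card (Plaq A d)) - (A1 + A2 + X)) =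
      -β * (↑N * ↑(Fintype.card (Plaq A d))) + β * A1 + β * A2 + β * X by ring,
    Real.exp_add, Real.exp_add, Real.exp_add]
  push_cast
  ring

/-! ## Reflection positivity for covariant observables -/

open scoped Classical in
/-- **Reflection positivity of the Boltzmann weight, covariant form** (`β ≥ 0`): for bounded
measurable `g_κ` depending only on `P ∪ C` and a measurable `Φ` with
`Φ (midTranslate Y U) = Σ_κ g_κ(splice_C(U,Y)) conj g_κ(ΘU)`: `0 ≤ ∫ e^{-β S(U)} Φ(U) ∏ dU`. -/
theorem integral_midCov_nonneg (hρ : Continuous ρ) {β : ℝ} (hβ : 0 ≤ β) {K : Type*} [Fintype K]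
    {g : K → Config A d G → ℂ} (hgm : ∀ κ, Measurable (g κ)) {Kg : ℝ} (hgb : ∀ κ U, ‖g κ U‖ ≤ Kg)
    (hgdep : ∀ κ (U V : Config A d G),
      (∀ l, IsMidPosLink e Q h l ∨ IsMidCrossLink k Q h l → U l = V l) → g κ U = g κ V)
    {Φ : Config A d G → ℂ} (hΦm : Measurable Φ)
    (hcov : ∀ U Y, Φ (midTranslate k Q h Y U) =
      ∑ κ, g κ (LatticeRP.splice (midCrossBlock k Q h) (U, Y)) * conj (g κ (configMidReflect e k σ U))) :
    0 ≤ ∫ U, (Real.exp (-β * wilsonAction ρ e U) : ℂ) * Φ U ∂(productHaar A d G) := by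
  haveI : IsProbabilityMeasure (haarProbability G) :=
    CompactGroup.isProbabilityMeasure_haarMeasure_top
  haveI := isProbabilityMeasure_productHaar (A := A) (d := d) (G := G)
  set μ : Measure (Config A d G) := productHaar A d G with hμ
  set H : Config A d G → ℂ := fun U => (Real.exp (-β * wilsonAction ρ e U) : ℂ) * Φ U with hH
  have hHm : Measurable H :=
    (Complex.measurable_ofReal.comp
      ((continuous_const.mul (continuous_wilsonAction ρ hρ e)).measurable.exp)).mul hΦm
  have hR : ∀ U Y, H (midTranslate k Q h Y U) = ∑ κ, midIntegrand₂ ρ e k σ Q h hρ β (g κ) (U, Y) :=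
    fun U Y => hF.midCovIntegrand_midTranslate ρ hρ hβ hcov U Y
  have hRi : ∀ κ, Integrable (midIntegrand₂ ρ e k σ Q h hρ β (g κ)) (μ.prod μ) := fun κ =>
    Integrable.of_bound (measurable_midIntegrand₂ ρ hρ β (hgm κ)).aestronglyMeasurable _
      (ae_of_all _ (norm_midIntegrand₂_le ρ hρ hβ (hgb κ)))
  have hRsi : Integrable (fun p => ∑ κ, midIntegrand₂ ρ e k σ Q h hρ β (g κ) p) (μ.prod μ) :=
    integrable_finsetSum _ fun κ _ => hRi κ
  have step1 : ∫ U, H U ∂μ = ∫ Y, ∫ U, ∑ κ, midIntegrand₂ ρ e k σ Q h hρ β (g κ) (U, Y) ∂μ ∂μ := by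
    have hY : ∀ Y, ∫ U, H U ∂μ = ∫ U, ∑ κ, midIntegrand₂ ρ e k σ Q h hρ β (g κ) (U, Y) ∂μ :=
      fun Y => by
      rw [← LatticeRP.integral_comp_eq_of_measurePreserving (measurePreserving_midTranslate Y) hHm]
      exact integral_congr_ae (ae_of_all _ fun U => hR U Y)
    calc ∫ U, H U ∂μ = ∫ _Y, (∫ U, H U ∂μ) ∂μ := by rw [integral_const, probReal_univ, one_smul]
      _ = ∫ Y, ∫ U, ∑ κ, midIntegrand₂ ρ e k σ Q h hρ β (g κ) (U, Y) ∂μ ∂μ :=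
          integral_congr_ae (ae_of_all _ hY)
  rw [step1, ← integral_prod_symm _ hRsi, integral_finsetSum _ fun κ _ => hRi κ]
  refine Finset.sum_nonneg fun κ _ => ?_
  unfold midIntegrand₂
  rw [integral_const_mul]
  refine mul_nonneg (Complex.zero_le_real.2 (Real.exp_pos _).le) ?_
  have key := LatticeRP.integral_mul_conj_mul_exp_nonneg (haarProbability G) (midPosBlock e Q h)
    (midCrossBlock k Q h) (configMidReflect e k σ) hF.measurePreserving_configMidReflect
    (fun l hl => hF.dependsOn_configMidReflect_apply l hl)
    (g := midGObs ρ e k Q h β (g κ)) (a := fun ι V => midCoeff ρ e k Q h hρ β ι V)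
    (measurable_midGObs ρ hρ β (hgm κ)) (fun ι => measurable_midCoeff ρ hρ β ι)
    (norm_midGObs_le ρ hρ hβ (hgb κ)) (fun ι V => norm_midCoeff_le ρ hρ β ι V)
    (fun U V hUV => hF.midGObs_congr_of_posCross ρ β (hgdep κ) (eq_on_of_eq_on_midBlocks hUV))
    (fun ι U V hUV => hF.midCoeff_congr ρ hρ β ι (eq_on_of_eq_on_midBlocks hUV))
  unfold productHaar at hμ
  rw [hμ]
  exact key

open scoped Classical in
/-- ★★ **Link (mid-plane) reflection positivity for COVARIANT observables** on a periodic lattice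
with a site frame (Osterwalder–Seiler): for a compact second countable `G`, continuous `ρ`,
`β ≥ 0`, finitely many bounded measurable `g_κ` depending only on the positive and crossing
links, and a measurable `Φ` (automatically bounded: take `Y = 1`) with
`Φ (midTranslate Y U) = Σ_κ g_κ(splice_C(U, Y)) · conj g_κ(Θ U)` for all `U, Y`:
`0 ≤ ∫ Φ dμ_β` (`μ_β = gibbs ρ e β`). The plain theorem `linkRP_integral_conj_mul_nonneg` is the
case `g = F`; a Wilson loop bisected by `h = ½` is such a `Φ`. -/
theorem linkRP_nonneg_of_covariant (hρ : Continuous ρ) {β : ℝ} (hβ : 0 ≤ β) {K : Type*} [Fintype K]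
    {g : K → Config A d G → ℂ} (hgm : ∀ κ, Measurable (g κ)) {Kg : ℝ} (hgb : ∀ κ U, ‖g κ U‖ ≤ Kg)
    (hgdep : ∀ κ (U V : Config A d G),
      (∀ l, IsMidPosLink e Q h l ∨ IsMidCrossLink k Q h l → U l = V l) → g κ U = g κ V)
    {Φ : Config A d G → ℂ} (hΦm : Measurable Φ)
    (hcov : ∀ U Y, Φ (midTranslate k Q h Y U) =
      ∑ κ, g κ (LatticeRP.splice (midCrossBlock k Q h) (U, Y)) * conj (g κ (configMidReflect e k σ U))) :
    0 ≤ ∫ U, Φ U ∂(gibbs ρ e β) := by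
  have hZ := normaliser_pos (A := A) (G := G) ρ hρ e β
  rw [integral_gibbs]
  simp_rw [Complex.real_smul, Complex.ofReal_div, div_eq_mul_inv, mul_comm (Complex.ofReal _)
    ((_ : ℂ)⁻¹), mul_assoc]
  rw [integral_const_mul]
  refine mul_nonneg ?_ (hF.integral_midCov_nonneg ρ hρ hβ hgm hgb hgdep hΦm hcov)
  rw [← Complex.ofReal_inv]
  exact Complex.zero_le_real.2 (inv_nonneg.2 hZ.le)

end IsSiteFrame

end TiltedRP

end Summit.QuantumFields.GaugeBoot
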